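import Literature.Probability.Percolation.SlabRSWGluingBound
import Literature.Probability.Percolation.SlabGluingFact2
import Mathlib.Combinatorics.Pigeonhole
import HarnessLib

/-!
# Newman–Tassion–Wu 2017, §3.2, proof of Theorem 3.7 — FACT 2 with `|U| > t` in general position:
# the probabilistic half (`P[𝒳_ρ ∩ {|U| ≥ t}] ≤ (C₂/t) · P[C ⟷^R A]` from a located gadget at every
# point of the statistic)

Topic: `Literature/Probability/Percolation`. Second file of the HIGH-PROBABILITY regime (Layer 1b)
of the port of §3 of Newman–Tassion–Wu (CPAM 70 (2017); arXiv:1512.09107) on the general-position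
data `NTW17.GlueData`. Printed statement (pp. 9–10): "**Fact 2.** There exists `C₂ < ∞`, depending
only on `ε` and `k`, such that for any `t > 8`, `P_p[𝒳 ∩ {|U| > t}] ≤ (C₂/(t-8)) P_p[𝒳′]`. We prove
Fact 2 by constructing a map `Φ : 𝒳 ∩ {|U| > t} → 𝔓(𝒳′)` … For any `z ∈ U(ω)` that is not one of the
eight corners of `S`, we will construct a new configuration `ω^{(z)}` and define
`Φ(ω) = {ω^{(z)} : z ∈ U(ω), …}`."

The PROBABILISTIC content is: if at EVERY point `y` of a finite, window-determined statistic
`U(ω)` a local modification `ω ↦ ω^{(y)}` is available — gluing `C` to `A` inside `R̄`, changing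
only pairs touching a cleared set `D_y ⊆ y + B_r`, and RECOVERABLE from the image through one of
the three statistics of the tree's `GadgetSpec` (`att`, `attT(C → A)`, `attT(A → C)`) lying inside
`D̄_y` — then Lemma 3.5 (the tree's `lemma7_bond`) applied to the multi-valued map over a
`2r`-separated subfamily of `U(ω)` of one recovery type (pigeonhole over the three types; images at
separated points of the same type are distinct because their statistics lie in disjoint boxes) gives
**`P_p[𝒳_ρ ∩ {|U| ≥ t}] ≤ (3 (4r+1)² λ^s / t) · P_p[C ⟷^R A]`**, `λ = 2/min{p,1-p}`,
`s = 3(5k+4)(4r+1)²`.  This file proves exactly that (`NTW17.fact2_of_gadgets`), leaving to the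
geometric layer the supply of a located gadget (`NTW17.GadgetAt`) at every point of the chosen
statistic — for the statistic `GlueData.Uset` of Fact 1 (`SlabRSWGluingFactOne.lean`) this is NTW's
three-step construction around a point of `U(ω)` (the tree has it at the FIRST contact:
`exists_surgery_far`, `exists_surgery_ext`, direct glues near `A`/`C`).  With Fact 1 and the
`ε-δ` bookkeeping `NTW17.exists_delta_of_facts`, the high-probability gluing lemma follows.

* `NTW17.statOf` (the three recovery statistics as a `Fin 3`-indexed family), `NTW17.GadgetAt`
  (a `GadgetSpec` whose cleared set lies in `y + B_r`), `GadgetAt.toGadgetSpec`.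
* **`NTW17.fact2_of_gadgets`** — PROVED.

## Sources

* C. M. Newman, V. Tassion, W. Wu, *Critical percolation and the minimal spanning tree in
  slabs*, Comm. Pure Appl. Math. 70 (2017) 2084–2120, arXiv:1512.09107: §3.2, Lemma 3.5 and the
  proof of Theorem 3.7, Fact 2 (pp. 9–10 of the arXiv text) [NewmanTassionWu2017].
* H. Duminil-Copin, V. Sidoravicius, V. Tassion, CPAM 69 (2016), §2.3, Fact 2 (separated subfamily
  of `U(ω)`, distinct images; the tree's `fact2_large`) [DuminilCopinSidoraviciusTassion2016].
-/

noncomputable section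

namespace Literature.Probability.Percolation

open MeasureTheory LatticeModels SimpleGraph Finset

namespace NTW17

variable {k : ℕ}

/-! ## Located gadgets -/

/-- The three recovery statistics of the tree's `GadgetSpec`, indexed by `Fin 3`: the attachment
statistic `att` of a rerouting surgery and the two transverse statistics `attT` of the direct glues.
[cite: NewmanTassionWu2017, §3.2 (proof of Theorem 3.7, "z is the only site … that is connected to C")] -/
def statOf (Q : GlueData) (k : ℕ) (i : Fin 3) (ω' : BondConfig (slab 3 k)) : Set (slab 3 k) :=
  if i = 0 then Q.att k ω' else if i = 1 then attT k Q.R Q.C Q.A ω' else attT k Q.R Q.A Q.C ω'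

/-- **A located local modification** `ω ↦ ω'` at the planar point `y` with box radius `r`: the image
glues `C` to `A` inside `R̄`, consists of old edges and lattice edges inside `R̄`, and there is a
cleared set `D ⊆ y + B_r` outside of whose columns `ω` and `ω'` agree and over which one of the three
recovery statistics of `ω'` lies, non-empty (NTW's `ω^{(z)}` for `z ∈ U(ω)`).
[cite: NewmanTassionWu2017, §3.2 (proof of Theorem 3.7, Fact 2: the configurations ω^{(z)})] -/
structure GadgetAt (Q : GlueData) (k r : ℕ) (ω ω' : BondConfig (slab 3 k)) (y : ℤ × ℤ) : Prop where
  /-- the image glues `C` to `A` -/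
  mem : ω' ∈ Q.evCA k
  /-- the image stays in the window -/
  window : ∀ e ∈ ω', e ∈ ω ∨ (e ∈ (slabGraph 3 k).edgeSet ∧ e ∈ (slabLift k Q.R).sym2)
  /-- the modification is local, located at `y`, and recoverable -/
  recover : ∃ D : Set (ℤ × ℤ), (∀ e, e ∉ touch k D → (e ∈ ω ↔ e ∈ ω')) ∧ D ⊆ sqBox y r ∧
    ∃ i : Fin 3, (statOf Q k i ω').Nonempty ∧ statOf Q k i ω' ⊆ slabLift k D

/-- A located gadget is a gadget. [cite: NewmanTassionWu2017, §3.2 (proof of Theorem 3.7)] -/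
theorem GadgetAt.toGadgetSpec {Q : GlueData} {r : ℕ} {ω ω' : BondConfig (slab 3 k)} {y : ℤ × ℤ}
    (h : GadgetAt Q k r ω ω' y) : GadgetSpec Q k r ω ω' := by
  obtain ⟨D, hag, hD, i, hne, hsub⟩ := h.recover
  refine ⟨h.mem, h.window, D, hag, ⟨y, hD⟩, ?_⟩
  fin_cases i
  · exact Or.inl ⟨by simpa [statOf] using hne, by simpa [statOf] using hsub⟩
  · exact Or.inr (Or.inl ⟨by simpa [statOf] using hne, by simpa [statOf] using hsub⟩)
  · exact Or.inr (Or.inr ⟨by simpa [statOf] using hne, by simpa [statOf] using hsub⟩)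

/-! ## Fact 2 from located gadgets -/

section Fact2

variable {Q : GlueData} {ρ r : ℕ}

/-- Two boxes of radius `r` around `2r`-separated centres are disjoint. [folklore] -/
private theorem not_mem_of_sep {y y' w : ℤ × ℤ} {r : ℕ} (hsep : y' ∉ sqBox y (2 * r))
    (hw : w ∈ sqBox y r) (hw' : w ∈ sqBox y' r) : False := by
  apply hsep
  have := mem_sqBox_add hw (GlueGeom.mem_sqBox_comm hw')
  simpa [two_mul] using this

/-- **NTW 2017, proof of Theorem 3.7, FACT 2 — the probabilistic half, general position.**  Let
`U : ω ↦ U(ω) ⊆ ℤ²` be a finite statistic determined by the edges inside `R̄`, and suppose that for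
every lattice configuration `ω ∈ 𝒳_ρ` and every `y ∈ U(ω)` there is a located gadget at `y` with box
radius `r` (`GadgetAt`).  Then for `0 < p < 1` and every `t ≥ 1`:
`P_p[𝒳_ρ ∩ {|U| ≥ t}] ≤ (3 (4r+1)² λ^s / t) · P_p[C ⟷^R A]`, `λ = 2/min{p,1-p}`, `s = 3(5k+4)(4r+1)²`.
Proof: the multi-valued map `ω ↦ {ω^{(y)} : y ∈ Sel(ω)}` over a `2r`-separated subfamily `Sel(ω)` of
`U(ω)` of the most frequent recovery type (`|Sel| ≥ |U| / (3 (4r+1)²)`); images are in `{C ⟷ A}`,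
pairwise distinct (their statistics lie in the disjoint boxes `y + B_r`), and every preimage of an
image agrees with it off the `≤ s` lattice edges near chosen points of the three statistics; Lemma 3.5.
[cite: NewmanTassionWu2017, §3.2 (proof of Theorem 3.7, Fact 2)] -/
theorem fact2_of_gadgets (U : BondConfig (slab 3 k) → Set (ℤ × ℤ)) (hUfin : ∀ ω, (U ω).Finite)
    (hUcongr : ∀ ω ω' : BondConfig (slab 3 k), (∀ e ∈ (slabLift k Q.R).sym2, e ∈ ω ↔ e ∈ ω') → U ω = U ω')
    (hgad : ∀ ω : BondConfig (slab 3 k), ω ⊆ (slabGraph 3 k).edgeSet → ω ∈ Q.evXn k ρ →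
      ∀ y ∈ U ω, ∃ ω', GadgetAt Q k r ω ω' y)
    (p : unitInterval) (hp0 : 0 < (p : ℝ)) (hp1 : (p : ℝ) < 1) (t : ℕ) (ht : 1 ≤ t) :
    (bondPercolation (slabGraph 3 k) p).real (Q.evXn k ρ ∩ {ω | t ≤ (U ω).ncard}) ≤
      (3 * (2 * (2 * r) + 1) ^ 2 * (2 / min (p : ℝ) (1 - p)) ^ (3 * ((5 * k + 4) * (2 * (2 * r) + 1) ^ 2))) / t *
        (bondPercolation (slabGraph 3 k) p).real (Q.evCA k) := by
  classical
  set P := bondPercolation (slabGraph 3 k) p with hP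
  -- the chosen gadgets and their types
  let gad : ∀ (ω : BondConfig (slab 3 k)) (h : ω ⊆ (slabGraph 3 k).edgeSet ∧ ω ∈ Q.evXn k ρ)
      (y : ℤ × ℤ), y ∈ U ω → BondConfig (slab 3 k) :=
    fun ω h y hy => Classical.choose (hgad ω h.1 h.2 y hy)
  have hgad' : ∀ ω h y hy, GadgetAt Q k r ω (gad ω h y hy) y :=
    fun ω h y hy => Classical.choose_spec (hgad ω h.1 h.2 y hy)
  let Dof : ∀ ω h y hy, Set (ℤ × ℤ) := fun ω h y hy => Classical.choose (hgad' ω h y hy).recover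
  have hDof : ∀ ω h y hy, (∀ e, e ∉ touch k (Dof ω h y hy) → (e ∈ ω ↔ e ∈ gad ω h y hy)) ∧
      Dof ω h y hy ⊆ sqBox y r ∧ ∃ i : Fin 3, (statOf Q k i (gad ω h y hy)).Nonempty ∧
        statOf Q k i (gad ω h y hy) ⊆ slabLift k (Dof ω h y hy) :=
    fun ω h y hy => Classical.choose_spec (hgad' ω h y hy).recover
  let typ : ∀ ω h y hy, Fin 3 := fun ω h y hy => Classical.choose (hDof ω h y hy).2.2
  have htyp : ∀ ω h y hy, (statOf Q k (typ ω h y hy) (gad ω h y hy)).Nonempty ∧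
      statOf Q k (typ ω h y hy) (gad ω h y hy) ⊆ slabLift k (Dof ω h y hy) :=
    fun ω h y hy => Classical.choose_spec (hDof ω h y hy).2.2
  -- the window
  have hRfin : (slabLift k Q.R).Finite := slabLift_finite k Q.hRfin
  set K' : Finset (Sym2 (slab 3 k)) := (finite_sym2 hRfin).toFinset with hK'def
  have hK'coe : (↑K' : Set (Sym2 (slab 3 k))) = (slabLift k Q.R).sym2 := Set.Finite.coe_toFinset _
  set Kfin : Finset (Sym2 (slab 3 k)) := K'.filter (· ∈ (slabGraph 3 k).edgeSet) with hKfin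
  have hK : ∀ e, e ∈ Kfin ↔ e ∈ K' ∧ e ∈ (slabGraph 3 k).edgeSet := fun e => Finset.mem_filter
  have hKE : ∀ e ∈ Kfin, e ∈ (slabGraph 3 k).edgeSet := fun e he => ((hK e).1 he).2
  have hagree : ∀ ω ω' : BondConfig (slab 3 k), ω ∩ ↑K' = ω' ∩ ↑K' →
      ∀ e ∈ (slabLift k Q.R).sym2, e ∈ ω ↔ e ∈ ω' := by
    intro ω ω' heq e he
    rw [← hK'coe] at he
    have := Set.ext_iff.1 heq e
    simp only [Set.mem_inter_iff, he, and_true] at this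
    exact this
  have hA : DeterminedBy (Q.evXn k ρ ∩ {ω | t ≤ (U ω).ncard}) ↑K' := by
    rw [determinedBy_iff]
    intro ω ω' heq
    simp only [Set.mem_inter_iff, Set.mem_setOf_eq]
    rw [GlueData.mem_evXn_congr (hagree ω ω' heq), hUcongr ω ω' (hagree ω ω' heq)]
  have hB : DeterminedBy (Q.evCA k) ↑K' := by
    rw [determinedBy_iff]
    intro ω ω' heq
    exact mem_slabConn_congr' (hagree ω ω' heq) subset_rfl
  -- lattice configurations inside the window
  have hlat : ∀ S : Finset (Sym2 (slab 3 k)), S ⊆ Kfin →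
      (↑S : Set (Sym2 (slab 3 k))) ⊆ (slabGraph 3 k).edgeSet := fun S hS e he => hKE e (hS he)
  have hnewK : ∀ (S : Finset (Sym2 (slab 3 k))) (hS : S ⊆ Kfin)
      (hSX : (↑S : BondConfig (slab 3 k)) ∈ Q.evXn k ρ) (y : ℤ × ℤ) (hy : y ∈ U ↑S),
      gad ↑S ⟨hlat S hS, hSX⟩ y hy ⊆ ↑Kfin := by
    intro S hS hSX y hy e he
    rcases (hgad' (↑S) ⟨hlat S hS, hSX⟩ y hy).window e he with h | ⟨h1, h2⟩
    · exact hS h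
    · rw [Finset.mem_coe, hK]
      exact ⟨by rw [← Finset.mem_coe, hK'coe]; exact h2, h1⟩
  have hcoe : ∀ (S : Finset (Sym2 (slab 3 k))) (hS : S ⊆ Kfin)
      (hSX : (↑S : BondConfig (slab 3 k)) ∈ Q.evXn k ρ) (y : ℤ × ℤ) (hy : y ∈ U ↑S),
      (↑(Kfin.filter (· ∈ gad ↑S ⟨hlat S hS, hSX⟩ y hy)) : Set (Sym2 (slab 3 k))) =
        gad ↑S ⟨hlat S hS, hSX⟩ y hy := by
    intro S hS hSX y hy
    ext e
    simp only [Finset.coe_filter, Set.mem_setOf_eq, and_iff_right_iff_imp]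
    exact fun he => hnewK S hS hSX y hy he
  -- the separated subfamily and its majority type
  let sel : ∀ ω : BondConfig (slab 3 k), Finset (ℤ × ℤ) :=
    fun ω => Classical.choose (exists_separated_subset (2 * r) (hUfin ω).toFinset)
  have hsel : ∀ ω, sel ω ⊆ (hUfin ω).toFinset ∧
      (∀ z ∈ sel ω, ∀ z' ∈ sel ω, z ≠ z' → z' ∉ sqBox z (2 * r)) ∧
      (hUfin ω).toFinset.card ≤ (2 * (2 * r) + 1) ^ 2 * (sel ω).card :=
    fun ω => Classical.choose_spec (exists_separated_subset (2 * r) (hUfin ω).toFinset)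
  have hselU : ∀ ω y, y ∈ sel ω → y ∈ U ω := fun ω y hy => (Set.Finite.mem_toFinset _).1 ((hsel ω).1 hy)
  -- the type of a selected point (junk `0` off the relevant configurations)
  let typS : ∀ (ω : BondConfig (slab 3 k)), (ω ⊆ (slabGraph 3 k).edgeSet ∧ ω ∈ Q.evXn k ρ) → ℤ × ℤ → Fin 3 :=
    fun ω h y => if hy : y ∈ U ω then typ ω h y hy else 0
  -- majority type
  have hmaj : ∀ (ω : BondConfig (slab 3 k)) (h : ω ⊆ (slabGraph 3 k).edgeSet ∧ ω ∈ Q.evXn k ρ),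
      (sel ω).Nonempty → ∃ i₀ : Fin 3, ((sel ω).card : ℝ) / 3 ≤ ((sel ω).filter fun y => typS ω h y = i₀).card := by
    intro ω h hne
    have hcard : 0 < (sel ω).card := Finset.card_pos.2 hne
    obtain ⟨i₀, -, hi₀⟩ := Finset.exists_lt_card_fiber_of_mul_lt_card_of_maps_to
      (s := sel ω) (t := (Finset.univ : Finset (Fin 3))) (f := fun y => typS ω h y)
      (n := ((sel ω).card - 1) / 3) (fun _ _ => Finset.mem_univ _) (by
        rw [Finset.card_univ, Fintype.card_fin]; omega)
    refine ⟨i₀, ?_⟩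
    have h1 : ((sel ω).card - 1) / 3 + 1 ≤ ((sel ω).filter fun y => typS ω h y = i₀).card := hi₀
    have h2 : (sel ω).card ≤ 3 * (((sel ω).card - 1) / 3 + 1) := by omega
    have h3 : ((sel ω).card : ℝ) ≤ 3 * ((((sel ω).card - 1) / 3 + 1 : ℕ) : ℝ) := by exact_mod_cast h2
    have h4 : ((((sel ω).card - 1) / 3 + 1 : ℕ) : ℝ) ≤ ((sel ω).filter fun y => typS ω h y = i₀).card := by
      exact_mod_cast h1
    linarith
  let i₀ : ∀ (ω : BondConfig (slab 3 k)), (ω ⊆ (slabGraph 3 k).edgeSet ∧ ω ∈ Q.evXn k ρ) → Fin 3 :=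
    fun ω h => if hne : (sel ω).Nonempty then Classical.choose (hmaj ω h hne) else 0
  let sel₀ : ∀ (ω : BondConfig (slab 3 k)), (ω ⊆ (slabGraph 3 k).edgeSet ∧ ω ∈ Q.evXn k ρ) → Finset (ℤ × ℤ) :=
    fun ω h => (sel ω).filter fun y => typS ω h y = i₀ ω h
  have hsel₀ : ∀ ω h, (sel ω).Nonempty → ((sel ω).card : ℝ) / 3 ≤ (sel₀ ω h).card := by
    intro ω h hne
    have : i₀ ω h = Classical.choose (hmaj ω h hne) := dif_pos hne
    simp only [sel₀, this]
    exact Classical.choose_spec (hmaj ω h hne)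
  -- the multi-valued map
  let Φ : Finset (Sym2 (slab 3 k)) → Finset (Finset (Sym2 (slab 3 k))) := fun S =>
    if h : (↑S : Set (Sym2 (slab 3 k))) ⊆ (slabGraph 3 k).edgeSet ∧ (↑S : BondConfig (slab 3 k)) ∈ Q.evXn k ρ then
      (sel₀ ↑S h).attach.image fun y =>
        Kfin.filter (· ∈ gad ↑S h y.1 (hselU _ _ (Finset.mem_filter.1 y.2).1))
    else ∅
  have hΦ_of : ∀ (S : Finset (Sym2 (slab 3 k)))
      (h : (↑S : Set (Sym2 (slab 3 k))) ⊆ (slabGraph 3 k).edgeSet ∧ (↑S : BondConfig (slab 3 k)) ∈ Q.evXn k ρ),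
      Φ S = (sel₀ ↑S h).attach.image fun y =>
        Kfin.filter (· ∈ gad ↑S h y.1 (hselU _ _ (Finset.mem_filter.1 y.2).1)) := fun S h => dif_pos h
  set lam : ℝ := 2 / min (p : ℝ) (1 - p) with hlam
  set s₀ : ℕ := (5 * k + 4) * (2 * (2 * r) + 1) ^ 2 with hs₀
  set s : ℕ := 3 * s₀ with hs
  set M : ℝ := 3 * (2 * (2 * r) + 1) ^ 2 with hM
  have hMpos : 0 < M := by positivity
  have ht' : (0 : ℝ) < t / M := by positivity
  -- the window around a vertex
  let box : slab 3 k → Finset (Sym2 (slab 3 k)) := fun q₀ =>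
    Kfin.filter fun e => ∃ u ∈ e, planar k u ∈ (sqBox_finite (planar k q₀) (2 * r)).toFinset
  have hbox_card : ∀ q₀, (box q₀).card ≤ s₀ := by
    intro q₀
    refine (card_filter_colEdges_le k Kfin hKE _).trans ?_
    have := card_toFinset_sqBox_le (planar k q₀) (2 * r)
    rw [hs₀]; exact Nat.mul_le_mul_left _ this
  have hbox_agree : ∀ (S S' : Finset (Sym2 (slab 3 k))) (D : Set (ℤ × ℤ)) (q₀ : slab 3 k) (y : ℤ × ℤ),
      S ⊆ Kfin → S' ⊆ Kfin → planar k q₀ ∈ D → D ⊆ sqBox y r →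
      (∀ e, e ∉ touch k D → (e ∈ (↑S : BondConfig (slab 3 k)) ↔ e ∈ (↑S' : BondConfig (slab 3 k)))) →
      ∀ e, e ∉ box q₀ → (e ∈ S ↔ e ∈ S') := by
    intro S S' D q₀ y hS hS' hq₀D hDz hag e heT
    have hDq : D ⊆ sqBox (planar k q₀) (2 * r) := hDz.trans (sqBox_subset_double (hDz hq₀D))
    by_cases heK : e ∈ Kfin
    · have hnt : e ∉ touch k D := by
        rintro ⟨x, hx, hxD⟩
        exact heT (Finset.mem_filter.2 ⟨heK, x, hx, (Set.Finite.mem_toFinset _).2 (hDq hxD)⟩)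
      have := hag e hnt
      simp only [Finset.mem_coe] at this
      exact this
    · constructor
      · intro heS; exact absurd (hS heS) heK
      · intro heS'; exact absurd (hS' heS') heK
  have hmain := lemma7_bond (slabGraph 3 k) p hp0 hp1 K' Kfin hK hA hB s ht' Φ ?_ ?_ ?_
  · calc P.real (Q.evXn k ρ ∩ {ω | t ≤ (U ω).ncard}) ≤ lam ^ s / (t / M) * P.real (Q.evCA k) := hmain
      _ = M * lam ^ s / t * P.real (Q.evCA k) := by
        congr 1
        field_simp
  · -- images glue `C` to `A`
    intro S hS hSA S' hS'
    have h : (↑S : Set (Sym2 (slab 3 k))) ⊆ (slabGraph 3 k).edgeSet ∧ (↑S : BondConfig (slab 3 k)) ∈ Q.evXn k ρ :=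
      ⟨hlat S hS, hSA.1⟩
    rw [hΦ_of S h, Finset.mem_image] at hS'
    obtain ⟨y, -, rfl⟩ := hS'
    refine ⟨Finset.filter_subset _ _, ?_⟩
    have hyU := hselU _ _ (Finset.mem_filter.1 y.2).1
    rw [hcoe S hS h.2 y.1 hyU]
    exact (hgad' (↑S) h y.1 hyU).mem
  · -- at least `t / M` images
    intro S hS hSA
    have h : (↑S : Set (Sym2 (slab 3 k))) ⊆ (slabGraph 3 k).edgeSet ∧ (↑S : BondConfig (slab 3 k)) ∈ Q.evXn k ρ :=
      ⟨hlat S hS, hSA.1⟩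
    rw [hΦ_of S h]
    obtain ⟨hsub, hsep, hcard⟩ := hsel (↑S : BondConfig (slab 3 k))
    -- injectivity: statistics of the same type in disjoint boxes
    have hinj : Set.InjOn (fun y : {y // y ∈ sel₀ (↑S : BondConfig (slab 3 k)) h} =>
        Kfin.filter (· ∈ gad ↑S h y.1 (hselU _ _ (Finset.mem_filter.1 y.2).1)))
        ↑((sel₀ (↑S : BondConfig (slab 3 k)) h).attach) := by
      rintro ⟨y, hy⟩ - ⟨y', hy'⟩ - heq
      simp only at heq
      by_contra hne
      have hne' : y ≠ y' := fun h => hne (Subtype.ext h)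
      obtain ⟨hysel, hyt⟩ := Finset.mem_filter.1 hy
      obtain ⟨hy'sel, hy't⟩ := Finset.mem_filter.1 hy'
      have hyU := hselU _ _ hysel
      have hy'U := hselU _ _ hy'sel
      have heq' : gad ↑S h y hyU = gad ↑S h y' hy'U := by
        rw [← hcoe S hS h.2 y hyU, ← hcoe S hS h.2 y' hy'U, heq]
      -- both types equal `i₀`
      have ht1 : typ ↑S h y hyU = i₀ ↑S h := by
        have : typS ↑S h y = typ ↑S h y hyU := dif_pos hyU
        rw [← this, hyt]
      have ht2 : typ ↑S h y' hy'U = i₀ ↑S h := by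
        have : typS ↑S h y' = typ ↑S h y' hy'U := dif_pos hy'U
        rw [← this, hy't]
      obtain ⟨hne1, hsub1⟩ := htyp ↑S h y hyU
      obtain ⟨-, hsub2⟩ := htyp ↑S h y' hy'U
      rw [ht1] at hne1 hsub1
      rw [ht2] at hsub2
      obtain ⟨q, hq⟩ := hne1
      have hq1 : planar k q ∈ Dof ↑S h y hyU := by
        have := hsub1 hq; rwa [mem_slabLift_iff] at this
      have hq2 : planar k q ∈ Dof ↑S h y' hy'U := by
        rw [heq'] at hq
        have := hsub2 hq; rwa [mem_slabLift_iff] at this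
      exact not_mem_of_sep (hsep y hysel y' hy'sel hne') ((hDof ↑S h y hyU).2.1 hq1)
        ((hDof ↑S h y' hy'U).2.1 hq2)
    rw [Finset.card_image_of_injOn hinj, Finset.card_attach]
    -- counting
    have htU : t ≤ (U (↑S : BondConfig (slab 3 k))).ncard := hSA.2
    rw [Set.ncard_eq_toFinset_card _ (hUfin _)] at htU
    have hselne : (sel (↑S : BondConfig (slab 3 k))).Nonempty := by
      rw [Finset.nonempty_iff_ne_empty]
      intro hempty
      rw [hempty, Finset.card_empty, mul_zero] at hcard
      omega
    have h0 := hsel₀ ↑S h hselne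
    have hc' : ((hUfin (↑S : BondConfig (slab 3 k))).toFinset.card : ℝ) ≤
        (2 * (2 * r) + 1) ^ 2 * (sel (↑S : BondConfig (slab 3 k))).card := by exact_mod_cast hcard
    have htU' : (t : ℝ) ≤ (hUfin (↑S : BondConfig (slab 3 k))).toFinset.card := by exact_mod_cast htU
    rw [hM, div_le_iff₀ hMpos]
    have hsq : (0 : ℝ) < (2 * (2 * (r : ℝ)) + 1) ^ 2 := by positivity
    nlinarith
  · -- recovery window
    intro S' hS' _
    set ω' : BondConfig (slab 3 k) := ↑S' with hω'
    set T : Fin 3 → Finset (Sym2 (slab 3 k)) := fun i =>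
      if h : (statOf Q k i ω').Nonempty then box h.some else ∅ with hT
    have hTc : ∀ i, (T i).card ≤ s₀ := by intro i; simp only [hT]; split_ifs <;> simp [hbox_card]
    refine ⟨T 0 ∪ T 1 ∪ T 2, ?_, ?_⟩
    · calc (T 0 ∪ T 1 ∪ T 2).card ≤ (T 0 ∪ T 1).card + (T 2).card := Finset.card_union_le _ _
        _ ≤ ((T 0).card + (T 1).card) + (T 2).card := by gcongr; exact Finset.card_union_le _ _
        _ ≤ s₀ + s₀ + s₀ := by have := hTc 0; have := hTc 1; have := hTc 2; omega
        _ = s := by rw [hs]; ring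
    · intro S hS hSA hmem e heT
      have h : (↑S : Set (Sym2 (slab 3 k))) ⊆ (slabGraph 3 k).edgeSet ∧ (↑S : BondConfig (slab 3 k)) ∈ Q.evXn k ρ :=
        ⟨hlat S hS, hSA.1⟩
      rw [hΦ_of S h, Finset.mem_image] at hmem
      obtain ⟨⟨y, hy⟩, -, hyeq⟩ := hmem
      have hyU := hselU _ _ (Finset.mem_filter.1 hy).1
      have hω'eq : ω' = gad ↑S h y hyU := by rw [hω', ← hyeq, hcoe S hS h.2 y hyU]
      set i := typ ↑S h y hyU with hi
      obtain ⟨hne, hsub⟩ := htyp ↑S h y hyU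
      rw [← hi] at hne hsub
      have hag := (hDof ↑S h y hyU).1
      have hDy := (hDof ↑S h y hyU).2.1
      have hag' : ∀ e', e' ∉ touch k (Dof ↑S h y hyU) →
          (e' ∈ (↑S : BondConfig (slab 3 k)) ↔ e' ∈ (↑S' : BondConfig (slab 3 k))) := by
        intro e' he'
        rw [show ((↑S' : BondConfig (slab 3 k))) = gad ↑S h y hyU from hω' ▸ hω'eq]
        exact hag e' he'
      rw [← hω'eq] at hne hsub
      have hTi : T i = box hne.some := by simp only [hT]; rw [dif_pos hne]
      have hq₀D : planar k hne.some ∈ Dof ↑S h y hyU := by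
        have := hsub hne.some_mem; rwa [mem_slabLift_iff] at this
      have key : ∀ j : Fin 3, e ∈ T j → e ∈ T 0 ∪ T 1 ∪ T 2 := by
        intro j hj
        fin_cases j
        · exact Finset.mem_union_left _ (Finset.mem_union_left _ hj)
        · exact Finset.mem_union_left _ (Finset.mem_union_right _ hj)
        · exact Finset.mem_union_right _ hj
      have heTi : e ∉ T i := fun he => heT (key i he)
      exact hbox_agree S S' (Dof ↑S h y hyU) hne.some y hS hS' hq₀D hDy hag' e (hTi ▸ heTi)

end Fact2

end NTW17

end Literature.Probability.Percolation

end
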